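import Literature.NumberTheory.Automorphic.UnitaryConjugacyCompactModStabilizer     -- ★ p841422 (F-asm): compact mod `Stab(v₁)` under an abstract window `(𝒩, Λ₀)`
import Literature.LinearAlgebra.Matrix.RegularSemisimpleConjClassClosed             -- ★ `continuous_charpoly_coeff`
import Mathlib.Algebra.Polynomial.Derivative
import HarnessLib

/-!
# «COMPACT MODULO THE CENTRALISER» ON AN INVARIANT WINDOW: the window of ★ `exists_isCompact_conj_mem_imp_mem_mul_stab` made CONCRETE and cut out by
# conjugation INVARIANTS only — characteristic-polynomial coefficients within `ρ` of `(X − a)^k (X − u)` and the `v₁`-eigenvalue within `r` of `u`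
# (N6nsGerm (S1), binder `hD` of the (R-inv) junction, (B4-top) «the window», field level — FILE W1)

Topic `NumberTheory/Automorphic`; namespace `Literature.NumberTheory.Automorphic.UnitaryGroup`. KERNEL ONLY: theorems, no definition, no named fact, no instance, no notation,
no `sorry`.  Cell `pub/hodgecm-mathlib` (LEAD F0P3a-plan (g9) T8-38 (1) ∕ T8-87; p08 (g13)'s census `CENSUS-B4meas-OrbitalDescentCutoff` §4 (r4): Harish-Chandra's `β`-cut-off descent
binder `hD` is read on a STABLY SATURATED neighbourhood, so «compact mod `M`» is needed UNIFORMLY on a `t`-set that is a union of stable classes, not on a small box as in ★ p841633).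

THE STATEMENT.  `E` a proper non-trivially normed field, `σ` a continuous isometric ring involution, `J` hermitian non-degenerate, `2 ≠ 0`, `v₁` ANISOTROPIC, `a ≠ u`, `k + 1 = |n|`.
There are `ρ, r > 0` such that for every compact `Ω ⊆ M_n(E)` some compact `C ⊆ U(σ, J)` has: if `x, t ∈ U(σ, J)`, `t v₁ = l v₁` with `‖l − u‖ ≤ r`, `l σ(l) = 1`, the first `|n| + 1`
coefficients of `χ_t` are within `ρ` of those of `χ₀ := (X − a)^k (X − u)`, and `x t x⁻¹ ∈ Ω`, then `x ∈ C · Stab(v₁)`.  The `t`-set is described by the conjugation invariants `χ_t` and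
(for `t` in the centraliser of a block-scalar `ε` with `u`-line `E v₁`) the eigenvalue on `v₁` — so in the endoscopic application it is a union of stable classes.
PROOF = ★ (F-asm) with `Λ₀ := {l σ l = 1} ∩ B̄(u, r)`, `r := ‖u − a‖ ∕ 2`, and the CLOSED window `𝒩 := {ω ∣ ∀ i ≤ |n|, ‖χ_ω.coeff i − χ₀.coeff i‖ ≤ ρ}`; SIMPLICITY of every root
`l ∈ Λ₀` of `χ_ω`, `ω ∈ 𝒩`: on COEFFICIENT SPACE `E^{|n|+1} × Λ₀` the set `{(d, l) ∣ p_d(l) = 0 ∧ p_d′(l) = 0}` is closed and misses `{d₀} × Λ₀` (`χ₀(l) = (l − a)^k (l − u)` vanishes on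
`B̄(u, r)` only at `l = u`, where `χ₀′(u) = (u − a)^k ≠ 0`), so by the tube lemma it misses `B(d₀, ε) × Λ₀`; take `ρ := ε ∕ 2`; and `χ = (X − l) q` with `q(l) = χ′(l)`.

* **`exists_window_isCompact_conj_mem_imp_mulVec_eq`**.

HONEST SCOPE. Field-level topology of unitary groups; HC_CM is proved only modulo the printed citations until rung 0 closes; this file discharges no printed statement.

## References
* [HarishChandra1970] Harish-Chandra (notes by G. van Dijk), *Harmonic Analysis on Reductive p-adic Groups*, LNM 162 (1970), Part I §3 Lemma 19 + Corollary; Part II §5 (compactness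
  modulo the centraliser of a semisimple element, on an invariant neighbourhood).
* [Rogawski1990] J. D. Rogawski, *Automorphic Representations of Unitary Groups in Three Variables*, Ann. of Math. Stud. 123 (1990), §8.2 Prop. 8.2.1 pp. 112–116.
* [LanglandsShelstad1990Descent] R. P. Langlands, D. Shelstad, *Descent for transfer factors*, The Grothendieck Festschrift II (1990), §2.4 (invariant neighbourhoods).
-/

set_option autoImplicit false

noncomputable section

open Set Filter Topology Matrix Polynomial

namespace Literature.NumberTheory.Automorphic.UnitaryGroup

open Literature.LinearAlgebra.Matrix

variable {E : Type*} [NontriviallyNormedField E] {n : Type*} [Fintype n] [DecidableEq n] (σ : E →+* E) (J : Matrix n n E)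

omit [DecidableEq n] in
/-- Evaluation read on the first `N` coefficients: `Σ_{i<N} coeff_i l^i = p(l)` when `deg p < N`. [folklore] -/
private theorem sum_coeff_mul_pow_eq_eval {N : ℕ} (p : E[X]) (hp : p.natDegree < N) (l : E) :
    ∑ i : Fin N, p.coeff i * l ^ (i : ℕ) = p.eval l := by
  rw [Polynomial.eval_eq_sum_range' hp, ← Finset.sum_range (fun i => p.coeff i * l ^ i)]

omit [DecidableEq n] in
/-- The derivative read on the first `N` coefficients: `Σ_{i<N} coeff_i · i · l^{i−1} = p′(l)` when `deg p < N`. [folklore] -/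
private theorem sum_coeff_mul_mul_pow_eq_eval_derivative {N : ℕ} (p : E[X]) (hp : p.natDegree < N) (l : E) :
    ∑ i : Fin N, p.coeff i * ((i : ℕ) : E) * l ^ ((i : ℕ) - 1) = p.derivative.eval l := by
  rw [Polynomial.derivative_eval, Polynomial.sum_over_range' p (fun i => by rw [zero_mul, zero_mul]) N hp,
    ← Finset.sum_range (fun i => p.coeff i * ((i : ℕ) : E) * l ^ (i - 1))]

/-- **HARISH-CHANDRA'S COMPACTNESS MOD `Stab(v₁)` ON AN INVARIANT WINDOW.**  See the module docstring.
[cite: HarishChandra1970, Part I §3 Lemma 19 + Corollary; Part II §5] [cite: Rogawski1990, §8.2 Prop. 8.2.1 pp. 112–116] [cite: LanglandsShelstad1990Descent, §2.4] -/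
theorem exists_window_isCompact_conj_mem_imp_mulVec_eq [ProperSpace E] (hσ : ∀ s, σ (σ s) = s) (hσc : Continuous σ) (hσi : ∀ x, ‖σ x‖ = ‖x‖)
    (hH : (J.map σ)ᵀ = J) (hJd : J.det ≠ 0) (h2 : (2 : E) ≠ 0) {v₁ : n → E} (hβ : hermForm σ J v₁ v₁ ≠ 0)
    {a u : E} (hau : a ≠ u) {k : ℕ} (hk : k + 1 = Fintype.card n) :
    ∃ ρ : ℝ, 0 < ρ ∧ ∃ r : ℝ, 0 < r ∧ ∀ Ω : Set (Matrix n n E), IsCompact Ω → ∃ C : Set ↥(unitaryGroupOfForm σ J), IsCompact C ∧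
      ∀ x t : ↥(unitaryGroupOfForm σ J), ∀ l : E, ‖l - u‖ ≤ r → l * σ l = 1 →
        ((t : GL n E) : Matrix n n E) *ᵥ v₁ = l • v₁ →
        (∀ i : Fin (Fintype.card n + 1), ‖((t : GL n E) : Matrix n n E).charpoly.coeff i - ((X - Polynomial.C a) ^ k * (X - Polynomial.C u)).coeff i‖ ≤ ρ) →
        (((x * t * x⁻¹ : ↥(unitaryGroupOfForm σ J)) : GL n E) : Matrix n n E) ∈ Ω →
        ∃ c ∈ C, ((((c⁻¹ * x : ↥(unitaryGroupOfForm σ J))) : GL n E) : Matrix n n E) *ᵥ v₁ = v₁ := by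
  classical
  set N : ℕ := Fintype.card n + 1 with hN
  set χ₀ : E[X] := (X - C a) ^ k * (X - C u) with hχ₀
  have hχ₀deg : χ₀.natDegree < N := by
    have h1 : χ₀.natDegree ≤ k + 1 := by
      refine Polynomial.natDegree_mul_le.trans (add_le_add ?_ (Polynomial.natDegree_X_sub_C_le _))
      refine Polynomial.natDegree_pow_le.trans ?_
      rw [Polynomial.natDegree_X_sub_C, mul_one]
    rw [hN, ← hk]
    exact Nat.lt_succ_of_le h1
  have hχdeg : ∀ ω : Matrix n n E, ω.charpoly.natDegree < N := fun ω => by rw [Matrix.charpoly_natDegree_eq_dim, hN]; exact Nat.lt_succ_self _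
  -- evaluation functionals on coefficient space
  let ev : (Fin N → E) × E → E := fun p => ∑ i : Fin N, p.1 i * p.2 ^ (i : ℕ)
  let ev' : (Fin N → E) × E → E := fun p => ∑ i : Fin N, p.1 i * ((i : ℕ) : E) * p.2 ^ ((i : ℕ) - 1)
  have hevc : Continuous ev := continuous_finsetSum _ fun i _ => ((continuous_apply i).comp continuous_fst).mul (continuous_snd.pow _)
  have hev'c : Continuous ev' := continuous_finsetSum _ fun i _ => (((continuous_apply i).comp continuous_fst).mul continuous_const).mul (continuous_snd.pow _)
  let d₀ : Fin N → E := fun i => χ₀.coeff i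
  -- the eigenvalue window
  set r : ℝ := ‖u - a‖ / 2 with hr
  have hr0 : 0 < r := by rw [hr]; exact half_pos (norm_pos_iff.2 (sub_ne_zero.2 (Ne.symm hau)))
  have hball : ∀ l ∈ Metric.closedBall u r, l ≠ a := by
    intro l hl hla
    rw [Metric.mem_closedBall, dist_eq_norm, hla, norm_sub_rev] at hl
    have : ‖u - a‖ ≤ ‖u - a‖ / 2 := hl
    linarith [norm_pos_iff.2 (sub_ne_zero.2 (Ne.symm hau))]
  set Λ₀ : Set E := {l | l * σ l = 1} ∩ Metric.closedBall u r with hΛ₀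
  have hΛc : IsCompact Λ₀ := (isCompact_closedBall u r).inter_left (isClosed_eq (continuous_id.mul hσc) continuous_const)
  have hΛ : ∀ l ∈ Λ₀, l * σ l = 1 := fun l hl => hl.1
  -- at `χ₀` every root in the ball is simple
  have hgood : ∀ l ∈ Λ₀, ev (d₀, l) ≠ 0 ∨ ev' (d₀, l) ≠ 0 := by
    intro l hl
    have h1 : ev (d₀, l) = χ₀.eval l := sum_coeff_mul_pow_eq_eval χ₀ hχ₀deg l
    have h2 : ev' (d₀, l) = χ₀.derivative.eval l := sum_coeff_mul_mul_pow_eq_eval_derivative χ₀ hχ₀deg l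
    rw [h1, h2]
    by_cases h0 : χ₀.eval l = 0
    · right
      have hla : (l - a) ^ k ≠ 0 := pow_ne_zero k (sub_ne_zero.2 (hball l hl.2))
      have hlu : l = u := by
        rw [hχ₀, eval_mul, eval_pow, eval_sub, eval_X, eval_C, eval_sub, eval_X, eval_C, mul_eq_zero] at h0
        exact sub_eq_zero.1 (h0.resolve_left hla)
      rw [hχ₀, derivative_mul, eval_add, eval_mul, eval_mul, eval_sub, eval_X, eval_C, hlu, sub_self, mul_zero, zero_add, derivative_sub, derivative_X,
        derivative_C, sub_zero, eval_one, mul_one, eval_pow, eval_sub, eval_X, eval_C]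
      exact pow_ne_zero k (sub_ne_zero.2 (Ne.symm hau))
    · exact Or.inl h0
  -- the tube lemma on coefficient space `× Λ₀`
  have hO : IsOpen {p : (Fin N → E) × E | ev p ≠ 0 ∨ ev' p ≠ 0} :=
    (isOpen_ne_fun hevc continuous_const).union (isOpen_ne_fun hev'c continuous_const)
  have htube : ∀ᶠ d in 𝓝 d₀, ∀ l ∈ Λ₀, ev (d, l) ≠ 0 ∨ ev' (d, l) ≠ 0 :=
    hΛc.eventually_forall_of_forall_eventually fun l hl => hO.mem_nhds (hgood l hl)
  obtain ⟨ε, hε, hεgood⟩ := Metric.eventually_nhds_iff.1 htube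
  refine ⟨ε / 2, half_pos hε, r, hr0, fun Ω hΩ => ?_⟩
  -- the closed window on matrices
  set 𝒩 : Set (Matrix n n E) := {ω | ∀ i : Fin N, ‖ω.charpoly.coeff i - χ₀.coeff i‖ ≤ ε / 2} with h𝒩
  have hNc : IsClosed 𝒩 := by
    have h : 𝒩 = ⋂ i : Fin N, {ω : Matrix n n E | ‖ω.charpoly.coeff i - χ₀.coeff i‖ ≤ ε / 2} := by
      ext ω; simp only [h𝒩, Set.mem_setOf_eq, Set.mem_iInter]
    rw [h]
    exact isClosed_iInter fun i => isClosed_le (((continuous_charpoly_coeff (i : ℕ)).sub continuous_const).norm) continuous_const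
  -- SIMPLICITY on `𝒩 × Λ₀`
  have hsimple : ∀ ω ∈ 𝒩, ∀ g ∈ unitaryGroupOfForm σ J, (g : Matrix n n E) = ω → ∀ l ∈ Λ₀, ∀ v : n → E, v ≠ 0 → ω *ᵥ v = l • v →
      ∃ q : E[X], ω.charpoly = (X - C l) * q ∧ q.eval l ≠ 0 := by
    rintro ω hω g - rfl l hl v hv0 hv
    have hroot : ((g : Matrix n n E)).charpoly.IsRoot l := by
      rw [← Matrix.charpoly_toLin', ← Module.End.hasEigenvalue_iff_isRoot_charpoly]
      exact Module.End.hasEigenvalue_of_hasEigenvector ⟨by rw [Module.End.mem_eigenspace_iff, Matrix.toLin'_apply]; exact hv, hv0⟩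
    have hd : dist (fun i : Fin N => ((g : Matrix n n E)).charpoly.coeff i) d₀ < ε := by
      refine (dist_pi_le_iff (half_pos hε).le).2 (fun i => ?_) |>.trans_lt (half_lt_self hε)
      rw [dist_eq_norm]
      exact hω i
    have hgood' := hεgood hd l hl
    have h1 : ev ((fun i : Fin N => ((g : Matrix n n E)).charpoly.coeff i), l) = ((g : Matrix n n E)).charpoly.eval l :=
      sum_coeff_mul_pow_eq_eval _ (hχdeg _) l
    have h2 : ev' ((fun i : Fin N => ((g : Matrix n n E)).charpoly.coeff i), l) = ((g : Matrix n n E)).charpoly.derivative.eval l :=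
      sum_coeff_mul_mul_pow_eq_eval_derivative _ (hχdeg _) l
    rw [h1, h2] at hgood'
    have hder : ((g : Matrix n n E)).charpoly.derivative.eval l ≠ 0 := hgood'.resolve_left (not_not.2 hroot)
    set q : E[X] := ((g : Matrix n n E)).charpoly /ₘ (X - C l) with hq
    have hχ : ((g : Matrix n n E)).charpoly = (X - C l) * q := (mul_divByMonic_eq_iff_isRoot.2 hroot).symm
    refine ⟨q, hχ, fun hq0 => hder ?_⟩
    have hd' : ((g : Matrix n n E)).charpoly.derivative = q + (X - C l) * q.derivative := by
      conv_lhs => rw [hχ]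
      rw [derivative_mul, derivative_sub, derivative_X, derivative_C, sub_zero, one_mul]
    rw [hd', eval_add, eval_mul, eval_sub, eval_X, eval_C, sub_self, zero_mul, add_zero, hq0]
  -- ★ (F-asm)
  obtain ⟨C, hCc, hC⟩ := exists_isCompact_conj_mem_imp_mem_mul_stab σ J hσ hσc hσi hH hJd h2 hβ hΛc hΛ hNc hsimple hΩ
  refine ⟨C, hCc, fun x t l hlr hl1 htv hcoef hxt => hC x t ⟨l, ⟨hl1, by rwa [Metric.mem_closedBall, dist_eq_norm]⟩, htv⟩ ⟨hxt, fun i => ?_⟩⟩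
  -- `x t x⁻¹ ∈ 𝒩`: the characteristic polynomial is a conjugation invariant
  have hχc : (((x * t * x⁻¹ : ↥(unitaryGroupOfForm σ J)) : GL n E) : Matrix n n E).charpoly = ((t : GL n E) : Matrix n n E).charpoly := by
    rw [Subgroup.coe_mul, Subgroup.coe_mul, Units.val_mul, Units.val_mul, Subgroup.coe_inv, Matrix.coe_units_inv]
    exact Matrix.charpoly_units_conj _ _
  rw [hχc]
  exact hcoef i

end Literature.NumberTheory.Automorphic.UnitaryGroup
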